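import Mathlib

/-!
# Single-defect exchange trajectories — BN3 classification (crux stmt-PneNP-19727 `FoolingMeasure`, planner r2s1g22)

WORKFILE (statements only, no proofs; census `IDEATION-CENSUS-r2s1g22.md` §2 has the paper proofs).
A *defect trajectory* on `Fin n` with `M` steps: a cyclic token walk `tok : ZMod M → Fin n`, an initial
colouring `col0 : Fin n → ZMod 3` and non-zero steps `step : ZMod M → ZMod 3`; the colouring at time `j+1`
is the colouring at time `j` with the token vertex `tok j` recoloured by `+ step j`.  The walk's consecutive
pairs are the edges of the SUPPORT graph; the trajectory is VALID when every support edge is traversed exactly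
once and, at every time `j`, the colouring is proper on the support except on the single edge
`{tok (j-1), tok j}`, which is monochromatic (closure up to a global shift).  One residue ruler of a normal
cycle system (`NormalCycleSystems.lean`) is the case `mult ≡ 1`.  Validity makes a non-3-colourable support
4-edge-critical for free (`CriticalOfValid`) — which is why the species was examined as a support law.
BN3 (proved on paper, census §2): (a) `StepParity` — the step is multiplied by `(-1)^(m u + m v)` across each
traversal; (b) the step is constant on each multiplicity-parity class; (c) same-class traversals force
alternating later visits and strictly decreasing return gaps, so a same-parity trajectory has no repeated
vertex (`NoSameParityTrajectory`: it is a residue ruler, `M ≡ 1 (mod 3)`); (d) a cross-class traversal admits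
at most one later visit of its endpoints; (e) hence EVERY valid trajectory has all multiplicities in `{1,2}`
(`MultiplicityLeTwo`), its support has maximum degree ≤ 4 with degree-2 vertices, and no trajectory species
lives on graphs of minimum degree ≥ 3 (`NoRepeatedOnlyTrajectory`, `NoMixedSpecies`); (f) `SizeLaw`: `n ≡ 1 (mod 3)`.
Exhaustive enumeration (census §2): all closed trajectories on `n ≤ 13` vertices have multiplicities in `{1,2}`.  Negative knowledge:
the residue-frame normal form is canonical among single-token exchange plantings, up to double points.
Kit evidence: j321473, j321629 (kissat on the CNF of `Valid`).
-/

namespace Summit.PneNP.PneNP.Cruxes.FoolingMeasure.DefectTrajectories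

open Finset

variable {n M : ℕ}

/-- Data of a cyclic single-defect exchange trajectory. -/
structure Trajectory (n M : ℕ) where
  tok : ZMod M → Fin n
  col0 : Fin n → ZMod 3
  step : ZMod M → ZMod 3
  step_ne : ∀ j, step j ≠ 0

/-- Colouring at (integer) time `j`: apply the first `j` recolourings. -/
def Trajectory.colAt (T : Trajectory n M) : ℕ → Fin n → ZMod 3
  | 0 => T.col0
  | j + 1 => fun v => T.colAt j v + (if v = T.tok (j : ZMod M) then T.step (j : ZMod M) else 0)

/-- The edge traversed between times `j` and `j+1`. -/
def Trajectory.edgeAt (T : Trajectory n M) (j : ZMod M) : Sym2 (Fin n) := s(T.tok j, T.tok (j + 1))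

/-- Support = set of traversed edges. -/
noncomputable def Trajectory.support (T : Trajectory n M) [NeZero M] : Finset (Sym2 (Fin n)) :=
  (Finset.univ : Finset (ZMod M)).image T.edgeAt

/-- Multiplicity of a vertex = number of times the token sits on it. -/
noncomputable def Trajectory.mult (T : Trajectory n M) [NeZero M] (v : Fin n) : ℕ :=
  ((Finset.univ : Finset (ZMod M)).filter (fun j => T.tok j = v)).card

/-- Validity: no immediate return, every edge traversed once (the `M` traversed edges are distinct and
loop-free), and at every time `j < M` the colouring `colAt j` is proper on the support except exactly on the
edge `{tok (j-1), tok j}`, which is monochromatic; closure up to a global shift. -/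
def Trajectory.Valid (T : Trajectory n M) [NeZero M] : Prop :=
  (∀ j : ZMod M, T.tok j ≠ T.tok (j + 1)) ∧
  (Function.Injective T.edgeAt) ∧
  (∀ j : ℕ, j < M → ∀ e ∈ T.support,
      (e = T.edgeAt ((j : ZMod M) - 1) ↔ ∀ u ∈ e, ∀ v ∈ e, T.colAt j u = T.colAt j v)) ∧
  (∃ s : ZMod 3, ∀ v, T.colAt M v = T.col0 v + s)

/-- The support graph. -/
def Trajectory.graph (T : Trajectory n M) [NeZero M] : SimpleGraph (Fin n) :=
  SimpleGraph.fromEdgeSet (T.support : Set (Sym2 (Fin n)))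

/-- FIRST LEMMA (species side, R3 compliance): a valid trajectory certifies 3-colourability of every
edge-deleted subgraph, so a non-3-colourable support is 4-edge-critical. -/
def CriticalOfValid (n M : ℕ) [NeZero M] : Prop :=
  ∀ T : Trajectory n M, T.Valid → ¬ T.graph.Colorable 3 →
    ∀ e ∈ T.support, (SimpleGraph.fromEdgeSet ((T.support.erase e : Finset (Sym2 (Fin n))) :
      Set (Sym2 (Fin n)))).Colorable 3

/-- BN3 (a), the PARITY LAW: across the traversal `tok j → tok (j+1)` the step is multiplied by
`(-1)^(mult (tok j) + mult (tok (j+1)))`. -/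
def StepParity (n M : ℕ) [NeZero M] : Prop :=
  ∀ T : Trajectory n M, T.Valid → ∀ j : ZMod M,
    T.step (j + 1) = (if Even (T.mult (T.tok j) + T.mult (T.tok (j + 1))) then 1 else -1) * T.step j

/-- BN3 (c), FRAMES ARE CANONICAL: if all multiplicities have the same parity then no vertex is repeated
(the trajectory is a residue ruler on a cycle of length `M ≡ 1 (mod 3)`). -/
def NoSameParityTrajectory (n M : ℕ) [NeZero M] : Prop :=
  ∀ T : Trajectory n M, T.Valid →
    (∀ u v : Fin n, 0 < T.mult u → 0 < T.mult v → Even (T.mult u + T.mult v)) →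
    ∀ v, T.mult v ≤ 1

/-- BN3 (e), CLASSIFICATION: every valid trajectory has all multiplicities at most two
(support of maximum degree ≤ 4). -/
def MultiplicityLeTwo (n M : ℕ) [NeZero M] : Prop :=
  ∀ T : Trajectory n M, T.Valid → ∀ v, T.mult v ≤ 2

/-- BN3 (e), corollary: no valid trajectory has all its visited vertices repeated (so none lives on a
graph of minimum degree ≥ 3; in particular none is 4-critical other than as one ruler of a system). -/
def NoRepeatedOnlyTrajectory (n M : ℕ) [NeZero M] : Prop :=
  ∀ T : Trajectory n M, T.Valid → (∃ v, 0 < T.mult v) → ∃ v, T.mult v = 1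

/-- BN3 (f), SIZE LAW: if every vertex is visited, `n ≡ 1 (mod 3)` (sum of the steps over one period equals the
global shift; exhaustive check `n ≤ 13`: trajectories exist exactly for `n = 4, 7, 10, 13`). -/
def SizeLaw (n M : ℕ) [NeZero M] : Prop :=
  ∀ T : Trajectory n M, T.Valid → (∀ v, 0 < T.mult v) → n % 3 = 1

/-- The species that was proposed and is killed by BN3 (e): valid, non-3-colourable, parity-mixed with
multiplicities in `{3,4}`. -/
def MixedSpecies (n M : ℕ) [NeZero M] (T : Trajectory n M) : Prop :=
  T.Valid ∧ ¬ T.graph.Colorable 3 ∧ (∀ v, T.mult v = 3 ∨ T.mult v = 4) ∧ (∃ v, T.mult v = 3) ∧ ∃ v, T.mult v = 4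

/-- BN3 (e) specialised: the mixed species is empty at every size (kit j321473: UNSAT / timeout at
`n ≤ 20`, consistent). -/
def NoMixedSpecies : Prop := ∀ n M : ℕ, ∀ _ : NeZero M, ∀ T : Trajectory n M, ¬ MixedSpecies n M T

end Summit.PneNP.PneNP.Cruxes.FoolingMeasure.DefectTrajectories
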